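import Summits.QuantumFields.YangMills.Theorems.FemtoTransferGapPositivity
import Literature.MathematicalPhysics.QuantumFieldTheory.PinnedOneLinkLaplaceIntegrals

/-!
# Femto transfer gap — rung W1-up, part 1/7: `SU(2)` algebra for the one-site trial states

Support module of the `FemtoTransferGap` group (cell `ym-beyond`, seat P1; route `LuscherReduction`, crux `OneSiteLevels` =
`stmt-QuantumFields-20007`), part 1/7 of the sorry-free proof of the registered BC5 rung `RungUpperK1` (`stub_rungW1up`):
`∃ C B0, ∀ B ≥ B0, e^{−C λ_b(B)} λ₀(B,1) ≤ λ₁(B,1)` on the ONE-SITE lattice (`rungUpperK1` in `FemtoTransferGapRungW1up`).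

Pure `SU(2)` matrix algebra: the centre (`negOne = −1`, `z ∈ Z(SU(2)) → z = ±1`), the trace identities
`‖W ∓ 1‖_F² = 4 ∓ 2 Re tr W`, the FROBENIUS DISTANCE TO THE CENTRE `vacDist W = min(‖W − 1‖_F, ‖W + 1‖_F)` (centre- and
conjugation-invariant, `1`-Lipschitz, continuous) and the one-site plaquette (COMMUTATOR) bound
`2 − Re tr(A B A⁻¹ B⁻¹) ≤ 2 vacDist(A)² vacDist(B)²` (the magnetic energy is quartic in the distance to the classical vacuum manifold).

## WHAT THIS IS NOT
NOT THE CLAY GAP; no statement about `L → ∞` or a continuum limit.  Everything below is proved (no `sorry`, no new axiom).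
-/

set_option autoImplicit false

noncomputable section

open MeasureTheory Filter Topology Real
open scoped Matrix ComplexConjugate
open Literature.MathematicalPhysics.QuantumFieldTheory
open Literature.MathematicalPhysics.QuantumLattice

namespace Summit.QuantumFields.YangMills.Theorems.FemtoTransferGap

/-! ### §1. The centre of `SU(2)` -/

/-- The non-trivial centre element `−1 ∈ SU(2)`. [folklore] -/
def negOne : SU2 :=
  ⟨-1, by
    rw [Matrix.mem_specialUnitaryGroup_iff]
    refine ⟨?_, by simp [Matrix.det_neg, Matrix.det_one]⟩
    rw [Matrix.mem_unitaryGroup_iff]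
    simp⟩

/-- `↑negOne = −1`. [folklore] -/
@[simp] theorem coe_negOne : ((negOne : SU2) : Matrix (Fin 2) (Fin 2) ℂ) = -1 := rfl

/-- `−1` commutes with everything. [folklore] -/
theorem negOne_mul_comm (g : SU2) : negOne * g = g * negOne :=
  Subtype.ext (by simp [Submonoid.coe_mul])

/-- `(−1)(−1) = 1`. [folklore] -/
@[simp] theorem negOne_mul_negOne : negOne * negOne = 1 :=
  Subtype.ext (by simp [Submonoid.coe_mul])

/-- `↑(−1 · g) = −↑g`. [folklore] -/
@[simp] theorem coe_negOne_mul (g : SU2) :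
    ((negOne * g : SU2) : Matrix (Fin 2) (Fin 2) ℂ) = -(g : Matrix (Fin 2) (Fin 2) ℂ) := by
  simp [Submonoid.coe_mul]

/-- `−1 ∈ Z(SU(2))`. [folklore] -/
theorem negOne_mem_center : negOne ∈ Subgroup.center SU2 :=
  Subgroup.mem_center_iff.2 fun g => (negOne_mul_comm g).symm

/-- The test element `diag(i, −i) ∈ SU(2)`. [folklore] -/
private def diagI : SU2 :=
  ⟨!![Complex.I, 0; 0, -Complex.I], by
    rw [Matrix.mem_specialUnitaryGroup_iff, Matrix.mem_unitaryGroup_iff]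
    refine ⟨?_, ?_⟩
    · ext i j
      fin_cases i <;> fin_cases j <;>
        simp [Matrix.mul_apply, Fin.sum_univ_two, Matrix.star_eq_conjTranspose, Matrix.conjTranspose_apply]
    · simp [Matrix.det_fin_two_of]⟩

/-- The test element `[[0, 1], [−1, 0]] ∈ SU(2)`. [folklore] -/
private def rotJ : SU2 :=
  ⟨!![0, 1; -1, 0], by
    rw [Matrix.mem_specialUnitaryGroup_iff, Matrix.mem_unitaryGroup_iff]
    refine ⟨?_, ?_⟩
    · ext i j
      fin_cases i <;> fin_cases j <;>
        simp [Matrix.mul_apply, Fin.sum_univ_two, Matrix.star_eq_conjTranspose, Matrix.conjTranspose_apply]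
    · simp [Matrix.det_fin_two_of]⟩

/-- **The centre of `SU(2)` is `{1, −1}`**: a central element commutes with `diag(i, −i)` (so it is diagonal) and with the rotation
`[[0,1],[−1,0]]` (so its diagonal entries agree); `det = 1` then forces `±1`. [cite: Sepanski2007, Exercise 1.7 (a)] -/
theorem eq_one_or_eq_negOne_of_mem_center {z : SU2} (hz : z ∈ Subgroup.center SU2) : z = 1 ∨ z = negOne := by
  have h1 : (diagI * z : SU2) = z * diagI := Subgroup.mem_center_iff.1 hz diagI
  have h2 : (rotJ * z : SU2) = z * rotJ := Subgroup.mem_center_iff.1 hz rotJ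
  have h1' : (diagI : Matrix (Fin 2) (Fin 2) ℂ) * z = (z : Matrix (Fin 2) (Fin 2) ℂ) * diagI := by
    have := congrArg Subtype.val h1; simpa only [Submonoid.coe_mul] using this
  have h2' : (rotJ : Matrix (Fin 2) (Fin 2) ℂ) * z = (z : Matrix (Fin 2) (Fin 2) ℂ) * rotJ := by
    have := congrArg Subtype.val h2; simpa only [Submonoid.coe_mul] using this
  have e01 : ((diagI : Matrix (Fin 2) (Fin 2) ℂ) * z) 0 1 = ((z : Matrix (Fin 2) (Fin 2) ℂ) * diagI) 0 1 := by rw [h1']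
  have e10 : ((diagI : Matrix (Fin 2) (Fin 2) ℂ) * z) 1 0 = ((z : Matrix (Fin 2) (Fin 2) ℂ) * diagI) 1 0 := by rw [h1']
  have f01 : ((rotJ : Matrix (Fin 2) (Fin 2) ℂ) * z) 0 1 = ((z : Matrix (Fin 2) (Fin 2) ℂ) * rotJ) 0 1 := by rw [h2']
  simp [diagI, rotJ, Matrix.mul_apply, Fin.sum_univ_two] at e01 e10 f01
  -- off-diagonal entries vanish
  have hb : (z : Matrix (Fin 2) (Fin 2) ℂ) 0 1 = 0 := by
    have : (2 * Complex.I) * (z : Matrix (Fin 2) (Fin 2) ℂ) 0 1 = 0 := by linear_combination e01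
    simpa [Complex.I_ne_zero] using this
  have hc : (z : Matrix (Fin 2) (Fin 2) ℂ) 1 0 = 0 := by
    have : (2 * Complex.I) * (z : Matrix (Fin 2) (Fin 2) ℂ) 1 0 = 0 := by linear_combination -e10
    simpa [Complex.I_ne_zero] using this
  have had : (z : Matrix (Fin 2) (Fin 2) ℂ) 0 0 = (z : Matrix (Fin 2) (Fin 2) ℂ) 1 1 := by
    linear_combination -f01
  have hdet : (z : Matrix (Fin 2) (Fin 2) ℂ).det = 1 := (Matrix.mem_specialUnitaryGroup_iff.1 z.2).2
  rw [Matrix.det_fin_two, hb, hc, ← had] at hdet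
  have hsq : ((z : Matrix (Fin 2) (Fin 2) ℂ) 0 0 - 1) * ((z : Matrix (Fin 2) (Fin 2) ℂ) 0 0 + 1) = 0 := by
    linear_combination hdet
  rcases mul_eq_zero.1 hsq with h | h
  · left
    apply Subtype.ext
    ext i j
    fin_cases i <;> fin_cases j <;> simp [hb, hc, ← had, sub_eq_zero.1 h]
  · right
    apply Subtype.ext
    ext i j
    fin_cases i <;> fin_cases j <;> simp [hb, hc, ← had, eq_neg_of_add_eq_zero_left h]

/-! ### §2. Frobenius-norm facts and the distance to the centre -/

/-- `‖−M‖_F = ‖M‖_F`. [folklore] -/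
theorem frobNorm_neg {n : Type*} [Fintype n] (M : Matrix n n ℂ) : frobNorm (-M) = frobNorm M := by
  unfold frobNorm
  simp

/-- `‖A B‖_F ≤ ‖A‖_F ‖B‖_F`. [folklore] -/
theorem frobNorm_mul_le' {N : ℕ} (A B : Matrix (Fin N) (Fin N) ℂ) : frobNorm (A * B) ≤ frobNorm A * frobNorm B := by
  have h := (open scoped Matrix.Norms.Frobenius in Matrix.frobenius_norm_mul A B)
  rw [frobNorm_eq_norm, frobNorm_eq_norm, frobNorm_eq_norm]
  exact h

/-- Elements of `SU(2)` are unitary matrices. [folklore] -/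
theorem su2_mem_unitaryGroup (W : SU2) : (W : Matrix (Fin 2) (Fin 2) ℂ) ∈ Matrix.unitaryGroup (Fin 2) ℂ :=
  su_mem_unitaryGroup W

/-- `‖W − 1‖_F² = 4 − 2 Re tr W` on `SU(2)`. [cite: HornJohnson2013, (0.2.5)] -/
theorem frobNorm_sub_one_sq (W : SU2) :
    frobNorm ((W : Matrix (Fin 2) (Fin 2) ℂ) - 1) ^ 2 = 4 - 2 * ((W : Matrix (Fin 2) (Fin 2) ℂ).trace).re := by
  set U : Matrix (Fin 2) (Fin 2) ℂ := (W : Matrix (Fin 2) (Fin 2) ℂ) with hU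
  have hU' : Uᴴ * U = 1 := by
    rw [← Matrix.star_eq_conjTranspose]; exact Matrix.mem_unitaryGroup_iff'.1 (su2_mem_unitaryGroup W)
  have hexp : (U - 1)ᴴ * (U - 1) = 1 + 1 - Uᴴ - U := by
    rw [Matrix.conjTranspose_sub, Matrix.conjTranspose_one, Matrix.sub_mul, Matrix.mul_sub, Matrix.mul_sub, hU',
      Matrix.one_mul, Matrix.mul_one, Matrix.one_mul]
    abel
  have h2 : (((Fintype.card (Fin 2) : ℕ) : ℂ)).re = 2 := by simp
  rw [frobNorm_sq_eq_re_trace, hexp, Matrix.trace_sub, Matrix.trace_sub, Matrix.trace_add, Matrix.trace_one,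
    Matrix.trace_conjTranspose]
  simp only [Complex.sub_re, Complex.add_re, Complex.star_def, Complex.conj_re, h2]
  ring

/-- `‖W + 1‖_F² = 4 + 2 Re tr W` on `SU(2)`. [cite: HornJohnson2013, (0.2.5)] -/
theorem frobNorm_add_one_sq (W : SU2) :
    frobNorm ((W : Matrix (Fin 2) (Fin 2) ℂ) + 1) ^ 2 = 4 + 2 * ((W : Matrix (Fin 2) (Fin 2) ℂ).trace).re := by
  set U : Matrix (Fin 2) (Fin 2) ℂ := (W : Matrix (Fin 2) (Fin 2) ℂ) with hU
  have hU' : Uᴴ * U = 1 := by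
    rw [← Matrix.star_eq_conjTranspose]; exact Matrix.mem_unitaryGroup_iff'.1 (su2_mem_unitaryGroup W)
  have hexp : (U + 1)ᴴ * (U + 1) = 1 + 1 + Uᴴ + U := by
    rw [Matrix.conjTranspose_add, Matrix.conjTranspose_one, Matrix.add_mul, Matrix.mul_add, Matrix.mul_add, hU',
      Matrix.one_mul, Matrix.mul_one, Matrix.one_mul]
    abel
  have h2 : (((Fintype.card (Fin 2) : ℕ) : ℂ)).re = 2 := by simp
  rw [frobNorm_sq_eq_re_trace, hexp, Matrix.trace_add, Matrix.trace_add, Matrix.trace_add, Matrix.trace_one,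
    Matrix.trace_conjTranspose]
  simp only [Complex.add_re, Complex.star_def, Complex.conj_re, h2]
  ring

/-- `2 − Re tr W = ‖W − 1‖_F²/2` on `SU(2)`. [cite: arXiv160201222, Lemma 7.2] -/
theorem two_sub_re_trace_eq (W : SU2) :
    2 - ((W : Matrix (Fin 2) (Fin 2) ℂ).trace).re = frobNorm ((W : Matrix (Fin 2) (Fin 2) ℂ) - 1) ^ 2 / 2 := by
  rw [frobNorm_sub_one_sq]; ring

/-- Parallelogram law on `SU(2)`: `‖W + 1‖_F² = 8 − ‖W − 1‖_F²`. [folklore] -/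
theorem frobNorm_add_one_sq_eq (W : SU2) :
    frobNorm ((W : Matrix (Fin 2) (Fin 2) ℂ) + 1) ^ 2 = 8 - frobNorm ((W : Matrix (Fin 2) (Fin 2) ℂ) - 1) ^ 2 := by
  rw [frobNorm_add_one_sq, frobNorm_sub_one_sq]; ring

/-- `Re tr W ≤ 2` on `SU(2)`. [folklore] -/
theorem re_trace_le_two (W : SU2) : ((W : Matrix (Fin 2) (Fin 2) ℂ).trace).re ≤ 2 := by
  have h := frobNorm_sub_one_sq W
  nlinarith [sq_nonneg (frobNorm ((W : Matrix (Fin 2) (Fin 2) ℂ) - 1))]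

/-- `−2 ≤ Re tr W` on `SU(2)`. [folklore] -/
theorem neg_two_le_re_trace (W : SU2) : -2 ≤ ((W : Matrix (Fin 2) (Fin 2) ℂ).trace).re := by
  have h := frobNorm_add_one_sq W
  nlinarith [sq_nonneg (frobNorm ((W : Matrix (Fin 2) (Fin 2) ℂ) + 1))]

/-- `‖W − 1‖_F² ≤ 8` on `SU(2)`. [folklore] -/
theorem frobNorm_sub_one_sq_le_eight (W : SU2) : frobNorm ((W : Matrix (Fin 2) (Fin 2) ℂ) - 1) ^ 2 ≤ 8 := by
  have h := frobNorm_add_one_sq_eq W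
  nlinarith [sq_nonneg (frobNorm ((W : Matrix (Fin 2) (Fin 2) ℂ) + 1))]

/-- `‖u − v‖_F = ‖u v⁻¹ − 1‖_F` on `SU(2)` (right unitary invariance). [folklore] -/
theorem frobNorm_sub_eq_mul_inv (u v : SU2) :
    frobNorm ((u : Matrix (Fin 2) (Fin 2) ℂ) - (v : Matrix (Fin 2) (Fin 2) ℂ)) =
      frobNorm (((u * v⁻¹ : SU2) : Matrix (Fin 2) (Fin 2) ℂ) - 1) := by
  have h1 : ((u * v⁻¹ : SU2) : Matrix (Fin 2) (Fin 2) ℂ) - 1 =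
      ((u : Matrix (Fin 2) (Fin 2) ℂ) - (v : Matrix (Fin 2) (Fin 2) ℂ)) * ((v⁻¹ : SU2) : Matrix (Fin 2) (Fin 2) ℂ) := by
    rw [Matrix.sub_mul, ← Submonoid.coe_mul, ← Submonoid.coe_mul, mul_inv_cancel]; rfl
  rw [h1, frobNorm_mul_unitary _ (su2_mem_unitaryGroup v⁻¹)]

/-- **Distance to the centre** `vacDist W = min(‖W − 1‖_F, ‖W + 1‖_F)`: the Frobenius distance of a link to the classical vacuum
manifold `{±1}` of the one-site model. [cite: Luscher1983] -/
def vacDist (W : SU2) : ℝ :=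
  min (frobNorm ((W : Matrix (Fin 2) (Fin 2) ℂ) - 1)) (frobNorm ((W : Matrix (Fin 2) (Fin 2) ℂ) + 1))

/-- `0 ≤ vacDist W`. [folklore] -/
theorem vacDist_nonneg (W : SU2) : 0 ≤ vacDist W := le_min (frobNorm_nonneg _) (frobNorm_nonneg _)

/-- `vacDist W ≤ ‖W − 1‖_F`. [folklore] -/
theorem vacDist_le_sub_one (W : SU2) : vacDist W ≤ frobNorm ((W : Matrix (Fin 2) (Fin 2) ℂ) - 1) := min_le_left _ _

/-- `vacDist W ≤ ‖W + 1‖_F`. [folklore] -/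
theorem vacDist_le_add_one (W : SU2) : vacDist W ≤ frobNorm ((W : Matrix (Fin 2) (Fin 2) ℂ) + 1) := min_le_right _ _

/-- `vacDist 1 = 0`. [folklore] -/
@[simp] theorem vacDist_one : vacDist 1 = 0 := by
  have h : frobNorm (((1 : SU2) : Matrix (Fin 2) (Fin 2) ℂ) - 1) = 0 := by simp [frobNorm_zero]
  exact le_antisymm (h ▸ vacDist_le_sub_one 1) (vacDist_nonneg 1)

/-- `vacDist(−W) = vacDist W`. [folklore] -/
theorem vacDist_negOne_mul (W : SU2) : vacDist (negOne * W) = vacDist W := by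
  unfold vacDist
  rw [coe_negOne_mul, min_comm,
    show -(W : Matrix (Fin 2) (Fin 2) ℂ) + 1 = -((W : Matrix (Fin 2) (Fin 2) ℂ) - 1) by abel,
    show -(W : Matrix (Fin 2) (Fin 2) ℂ) - 1 = -((W : Matrix (Fin 2) (Fin 2) ℂ) + 1) by abel,
    frobNorm_neg, frobNorm_neg]

/-- `vacDist(z W) = vacDist W` for central `z`. [folklore] -/
theorem vacDist_center_mul {z : SU2} (hz : z ∈ Subgroup.center SU2) (W : SU2) : vacDist (z * W) = vacDist W := by
  rcases eq_one_or_eq_negOne_of_mem_center hz with rfl | rfl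
  · rw [one_mul]
  · exact vacDist_negOne_mul W

/-- `vacDist(g W g⁻¹) = vacDist W` (conjugation invariance). [folklore] -/
theorem vacDist_conj (g W : SU2) : vacDist (g * W * g⁻¹) = vacDist W := by
  have hg := su2_mem_unitaryGroup g
  have hgi := su2_mem_unitaryGroup g⁻¹
  have hgg : (g : Matrix (Fin 2) (Fin 2) ℂ) * ((g⁻¹ : SU2) : Matrix (Fin 2) (Fin 2) ℂ) = 1 := by
    rw [← Submonoid.coe_mul, mul_inv_cancel]; rfl
  have key : ∀ s : ℂ,
      frobNorm (((g * W * g⁻¹ : SU2) : Matrix (Fin 2) (Fin 2) ℂ) - s • 1) =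
        frobNorm ((W : Matrix (Fin 2) (Fin 2) ℂ) - s • 1) := by
    intro s
    have h1 : ((g * W * g⁻¹ : SU2) : Matrix (Fin 2) (Fin 2) ℂ) - s • 1 =
        (g : Matrix (Fin 2) (Fin 2) ℂ) * ((W : Matrix (Fin 2) (Fin 2) ℂ) - s • 1) * ((g⁻¹ : SU2) : Matrix (Fin 2) (Fin 2) ℂ) := by
      rw [Matrix.mul_sub, Matrix.mul_smul, Matrix.mul_one, Matrix.sub_mul, Matrix.smul_mul, hgg, Submonoid.coe_mul,
        Submonoid.coe_mul]
    rw [h1, frobNorm_mul_unitary _ hgi, frobNorm_unitary_mul hg]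
  unfold vacDist
  have ha := key 1
  have hb := key (-1)
  simp only [one_smul, neg_smul, sub_neg_eq_add] at ha hb
  rw [ha, hb]

/-- `vacDist` is `1`-Lipschitz for the Frobenius distance. [folklore] -/
theorem abs_vacDist_sub_le (u v : SU2) :
    |vacDist u - vacDist v| ≤ frobNorm ((u : Matrix (Fin 2) (Fin 2) ℂ) - (v : Matrix (Fin 2) (Fin 2) ℂ)) := by
  set A : Matrix (Fin 2) (Fin 2) ℂ := (u : Matrix (Fin 2) (Fin 2) ℂ)
  set B : Matrix (Fin 2) (Fin 2) ℂ := (v : Matrix (Fin 2) (Fin 2) ℂ)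
  unfold vacDist
  refine (abs_min_sub_min_le_max _ _ _ _).trans (max_le ?_ ?_)
  · rw [abs_sub_le_iff]
    constructor
    · have := frobNorm_sub_le A B 1; linarith
    · have := frobNorm_sub_le B A 1; rw [frobNorm_sub_comm B A] at this; linarith
  · rw [abs_sub_le_iff]
    have e1 : A + 1 = A - (-1) := by abel
    have e2 : B + 1 = B - (-1) := by abel
    rw [e1, e2]
    constructor
    · have := frobNorm_sub_le A B (-1); linarith
    · have := frobNorm_sub_le B A (-1); rw [frobNorm_sub_comm B A] at this; linarith

/-- `vacDist v ≤ vacDist u + ‖u − v‖_F`. [folklore] -/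
theorem vacDist_le_add (u v : SU2) :
    vacDist v ≤ vacDist u + frobNorm ((u : Matrix (Fin 2) (Fin 2) ℂ) - (v : Matrix (Fin 2) (Fin 2) ℂ)) := by
  have := (abs_sub_le_iff.1 (abs_vacDist_sub_le u v)).2; linarith

/-- `vacDist` is continuous. [folklore] -/
theorem continuous_vacDist : Continuous vacDist := by
  unfold vacDist
  exact (continuous_frobNorm'.comp (continuous_subtype_val.sub continuous_const)).min
    (continuous_frobNorm'.comp (continuous_subtype_val.add continuous_const))

/-- A centre sign realising the minimum: `‖ε W − 1‖_F = vacDist W` with `ε` central (`ε ∈ {1, −1}`). [folklore] -/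
theorem exists_sign_vacDist (W : SU2) :
    ∃ ε : SU2, ε ∈ Subgroup.center SU2 ∧ frobNorm (((ε * W : SU2) : Matrix (Fin 2) (Fin 2) ℂ) - 1) = vacDist W := by
  by_cases h : frobNorm ((W : Matrix (Fin 2) (Fin 2) ℂ) - 1) ≤ frobNorm ((W : Matrix (Fin 2) (Fin 2) ℂ) + 1)
  · exact ⟨1, Subgroup.one_mem _, by rw [one_mul]; exact (min_eq_left h).symm⟩
  · refine ⟨negOne, negOne_mem_center, ?_⟩
    rw [coe_negOne_mul, vacDist, min_eq_right (le_of_not_ge h),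
      show -(W : Matrix (Fin 2) (Fin 2) ℂ) - 1 = -((W : Matrix (Fin 2) (Fin 2) ℂ) + 1) by abel, frobNorm_neg]

/-! ### §3. The one-site plaquette (commutator) bound -/

/-- `[V, V'] · (V' V) = V V'`. [folklore] -/
private theorem comm_mul_eq (V V' : SU2) : V * V' * V⁻¹ * V'⁻¹ * (V' * V) = V * V' := by group

/-- `‖[V,V'] − 1‖_F = ‖V V' − V' V‖_F`. [folklore] -/
theorem frobNorm_comm_sub_one (V V' : SU2) :
    frobNorm (((V * V' * V⁻¹ * V'⁻¹ : SU2) : Matrix (Fin 2) (Fin 2) ℂ) - 1) =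
      frobNorm ((V : Matrix (Fin 2) (Fin 2) ℂ) * (V' : Matrix (Fin 2) (Fin 2) ℂ) -
        (V' : Matrix (Fin 2) (Fin 2) ℂ) * (V : Matrix (Fin 2) (Fin 2) ℂ)) := by
  have hu : ((V' * V : SU2) : Matrix (Fin 2) (Fin 2) ℂ) ∈ Matrix.unitaryGroup (Fin 2) ℂ := su2_mem_unitaryGroup _
  calc frobNorm (((V * V' * V⁻¹ * V'⁻¹ : SU2) : Matrix (Fin 2) (Fin 2) ℂ) - 1)
      = frobNorm ((((V * V' * V⁻¹ * V'⁻¹ : SU2) : Matrix (Fin 2) (Fin 2) ℂ) - 1) * ((V' * V : SU2) : Matrix (Fin 2) (Fin 2) ℂ)) :=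
        (frobNorm_mul_unitary _ hu).symm
    _ = _ := by
        rw [Matrix.sub_mul, Matrix.one_mul, ← Submonoid.coe_mul, comm_mul_eq, Submonoid.coe_mul, Submonoid.coe_mul]

/-- Core commutator bound: `2 − Re tr[V,V'] ≤ 2 ‖V − 1‖_F² ‖V' − 1‖_F²`
(`V V' − V' V = (V−1)(V'−1) − (V'−1)(V−1)`). [cite: Luscher1983] -/
theorem two_sub_re_trace_comm_le_core (V V' : SU2) :
    2 - (((V * V' * V⁻¹ * V'⁻¹ : SU2) : Matrix (Fin 2) (Fin 2) ℂ).trace).re ≤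
      2 * frobNorm ((V : Matrix (Fin 2) (Fin 2) ℂ) - 1) ^ 2 * frobNorm ((V' : Matrix (Fin 2) (Fin 2) ℂ) - 1) ^ 2 := by
  rw [two_sub_re_trace_eq, frobNorm_comm_sub_one]
  set A : Matrix (Fin 2) (Fin 2) ℂ := (V : Matrix (Fin 2) (Fin 2) ℂ)
  set B : Matrix (Fin 2) (Fin 2) ℂ := (V' : Matrix (Fin 2) (Fin 2) ℂ)
  have hid : A * B - B * A = (A - 1) * (B - 1) - (B - 1) * (A - 1) := by noncomm_ring
  have h1 : frobNorm (A * B - B * A) ≤ 2 * (frobNorm (A - 1) * frobNorm (B - 1)) := by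
    rw [hid]
    calc frobNorm ((A - 1) * (B - 1) - (B - 1) * (A - 1))
        ≤ frobNorm ((A - 1) * (B - 1)) + frobNorm ((B - 1) * (A - 1)) := frobNorm_sub_le_add _ _
      _ ≤ frobNorm (A - 1) * frobNorm (B - 1) + frobNorm (B - 1) * frobNorm (A - 1) :=
          add_le_add (frobNorm_mul_le' _ _) (frobNorm_mul_le' _ _)
      _ = 2 * (frobNorm (A - 1) * frobNorm (B - 1)) := by ring
  have h0 : 0 ≤ frobNorm (A * B - B * A) := frobNorm_nonneg _
  have h2 : frobNorm (A * B - B * A) ^ 2 ≤ (2 * (frobNorm (A - 1) * frobNorm (B - 1))) ^ 2 :=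
    pow_le_pow_left₀ h0 h1 2
  nlinarith [h2]

/-- A central factor on the first letter does not change a commutator. [folklore] -/
theorem comm_center_mul_left {z : SU2} (hz : z ∈ Subgroup.center SU2) (A B : SU2) :
    (z * A) * B * (z * A)⁻¹ * B⁻¹ = A * B * A⁻¹ * B⁻¹ := by
  have hzi : z⁻¹ ∈ Subgroup.center SU2 := Subgroup.inv_mem _ hz
  have h : ∀ g X : SU2, g * (z⁻¹ * X) = z⁻¹ * (g * X) := fun g X => by
    rw [← mul_assoc, Subgroup.mem_center_iff.1 hzi g, mul_assoc]
  rw [mul_inv_rev]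
  calc z * A * B * (A⁻¹ * z⁻¹) * B⁻¹ = z * (A * (B * (A⁻¹ * (z⁻¹ * B⁻¹)))) := by simp only [mul_assoc]
    _ = z * (z⁻¹ * (A * (B * (A⁻¹ * B⁻¹)))) := by rw [h A⁻¹, h B, h A]
    _ = A * B * A⁻¹ * B⁻¹ := by rw [← mul_assoc, mul_inv_cancel, one_mul]; simp only [mul_assoc]

/-- A central factor on the second letter does not change a commutator. [folklore] -/
theorem comm_center_mul_right {z : SU2} (hz : z ∈ Subgroup.center SU2) (A B : SU2) :
    A * (z * B) * A⁻¹ * (z * B)⁻¹ = A * B * A⁻¹ * B⁻¹ := by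
  have h : ∀ g X : SU2, g * (z * X) = z * (g * X) := fun g X => by
    rw [← mul_assoc, Subgroup.mem_center_iff.1 hz g, mul_assoc]
  rw [mul_inv_rev]
  calc A * (z * B) * A⁻¹ * (B⁻¹ * z⁻¹) = A * (z * (B * (A⁻¹ * (B⁻¹ * z⁻¹)))) := by simp only [mul_assoc]
    _ = z * (A * (B * (A⁻¹ * (B⁻¹ * z⁻¹)))) := by rw [h A]
    _ = z * (A * (B * (A⁻¹ * B⁻¹))) * z⁻¹ := by simp only [mul_assoc]
    _ = A * B * A⁻¹ * B⁻¹ := by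
        rw [← Subgroup.mem_center_iff.1 hz (A * (B * (A⁻¹ * B⁻¹))), mul_assoc, mul_inv_cancel, mul_one]
        simp only [mul_assoc]

/-- **One-site plaquette bound**: `2 − Re tr(A B A⁻¹ B⁻¹) ≤ 2 · vacDist(A)² · vacDist(B)²` — the magnetic energy of the one-site
model is quartic in the distance of the links to the vacuum manifold `{±1}`. [cite: Luscher1983] -/
theorem two_sub_re_trace_comm_le_vacDist (A B : SU2) :
    2 - (((A * B * A⁻¹ * B⁻¹ : SU2) : Matrix (Fin 2) (Fin 2) ℂ).trace).re ≤ 2 * vacDist A ^ 2 * vacDist B ^ 2 := by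
  obtain ⟨ε, hε, hA⟩ := exists_sign_vacDist A
  obtain ⟨ε', hε', hB⟩ := exists_sign_vacDist B
  rw [← comm_center_mul_left hε A B, ← comm_center_mul_right hε' (ε * A) B, ← hA, ← hB]
  exact two_sub_re_trace_comm_le_core (ε * A) (ε' * B)

end Summit.QuantumFields.YangMills.Theorems.FemtoTransferGap

end
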